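import Summits.Ventures.LatticeQCDFlow.Scoring.SU2TorusPlaquetteSquare
import Summits.Ventures.LatticeQCDFlow.Scoring.SU2TorusPlaquetteLimit
import HarnessLib

/-!
# SU(2) on the 2-torus: `⟨(½ tr U_p)²⟩ = ¼(1 + 3 I₃(2β)/I₁(2β)) + O(r^{L²−1})` — the exact variance of a single plaquette

HONEST FRAMING: exact (Metropolis-corrected) sampling algorithms for lattice gauge theory;
figures of merit are autocorrelation/cost numbers at stated couplings and volumes; no
continuum-physics claim.

Venture `LatticeQCDFlow` (cell pub-lqcd), sub-topic `Scoring`; FANOUT row 5 (`s0-sun-a`), GEN-12.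
NEW WORK of the cell (placement rule); the finite-volume analysis of `SU2TorusPlaquetteSquare`
(`⟨(½ tr U_{x₀})²⟩_{(ℤ/L)²,β}` as a series), in the pattern of GEN-10's `SU2TorusPlaquetteFiniteVolume`.
With `λ_n = e^{−2β} I_{n+1}(2β)/β`, `r = λ_1/λ_0 = I₂(2β)/I₁(2β)`, `ρ = λ_2/λ_0 = I₃(2β)/I₁(2β)`:

* `abs_div_tsum_sq_sub_le` — abstract: for antitone positive summable `w`,
  `N = ¼ Σ_n [w_n w_{n+2}^v (n+1)/(n+3) + (1+[n≠0]) w_n^{v+1} + w_{n+2} w_n^v (n+3)/(n+1)]`, `Z = Σ_n w_n^{v+1}`: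
  `|N/Z − ¼(1 + 3 w_2/w_0)| ≤ (w_1/w_0)^v (1/12 + (9/4)(Σ_n w_{n+1})/w_0)`;
* **`abs_wilson_mean_su2a0_sq_plaquette_two_sub_le`** — for `β > 0`, every `L ≥ 1`:
  `|⟨(½ tr U_{x₀})²⟩_{(ℤ/L)²,β} − ¼(1 + 3 I₃(2β)/I₁(2β))| ≤ (I₂(2β)/I₁(2β))^{L²−1}·(1/12 + (9/4) Σ_n I_{n+2}(2β)/I₁(2β))`;
* **`abs_variance_su2a0_plaquette_two_sub_le`** — THE EXACT SINGLE-PLAQUETTE VARIANCE: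
  `|Var_{(ℤ/L)²,β}(½ tr U_{x₀}) − v(β)| ≤ (I₂/I₁)^{L²−1}·(7/12 + (29/4) Σ_n I_{n+2}/I₁)` with
  `v(β) = ¼(1 + 3 I₃(2β)/I₁(2β)) − (I₂(2β)/I₁(2β))²` (the one-plaquette / infinite-volume variance), where
  `Var(f) = ⟨f²⟩ − ⟨f⟩²`;
* `tendsto_wilson_mean_su2a0_sq_plaquette_two` — `⟨(½ tr U_0)²⟩_{(ℤ/(L+1))²,β} → ¼(1 + 3 I₃(2β)/I₁(2β))`.

The error-bar oracle: an ideal sampler drawing `N` independent configurations estimates the plaquette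
`⟨½ tr U_p⟩` with variance `Var(P̄)/N`, `P̄ = L⁻² Σ_p ½ tr U_p`; `Var(P̄) = Var(½ tr U_p)/L² + (1 − L⁻²)·Cov`
with `Cov = ⟨a₀(U_p)a₀(U_q)⟩ − ⟨a₀⟩²` the (pair-independent) covariance of two distinct plaquettes — NOT typed
here (it is `O(r^{L²−2})`: distinct plaquettes of 2-d Yang–Mills are independent in infinite volume).
Nothing is cited; no `def`.
-/

noncomputable section

open Real MeasureTheory Set Function Finset Filter Topology Polynomial.Chebyshev
open Literature.MathematicalPhysics.QuantumFieldTheory Literature.MathematicalPhysics.QuantumLattice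
open Literature.Analysis.FunctionSpaces
open Summit.Ventures.LatticeQCDFlow.Exactness
open Summit.Ventures.LatticeQCDFlow.Theory2.Lattice

namespace Summit.Ventures.LatticeQCDFlow.Scoring

/-! ## §1. The abstract estimate -/

section Abstract

variable {w : ℕ → ℝ} (hanti : Antitone w) (hpos : ∀ n, 0 < w n) (hsum : Summable w)
include hanti hpos hsum

/-- The second-moment numerator terms are summable. -/
theorem summable_sqNumTerm (v : ℕ) :
    Summable fun n : ℕ => (1 / 4 : ℝ) * (w n * w (n + 2) ^ v * (((n : ℝ) + 1) / ((n : ℝ) + 3)) +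
      (if n = 0 then 1 else 2) * w n ^ (v + 1) + w (n + 2) * w n ^ v * (((n : ℝ) + 3) / ((n : ℝ) + 1))) := by
  have hb : ∀ n : ℕ, (1 / 4 : ℝ) * (w n * w (n + 2) ^ v * (((n : ℝ) + 1) / ((n : ℝ) + 3)) +
      (if n = 0 then 1 else 2) * w n ^ (v + 1) + w (n + 2) * w n ^ v * (((n : ℝ) + 3) / ((n : ℝ) + 1))) ≤
      (1 / 4 : ℝ) * (w 0 ^ v * w n + 2 * (w 0 ^ v * w n) + 3 * (w 0 ^ v * w n)) := by
    intro n
    have hwn := hpos n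
    have hwn2 := hpos (n + 2)
    have hw0 := hpos 0
    have h1 : ((n : ℝ) + 1) / ((n : ℝ) + 3) ≤ 1 := by
      rw [div_le_one (by positivity)]; linarith
    have h2 : ((n : ℝ) + 3) / ((n : ℝ) + 1) ≤ 3 := by
      rw [div_le_iff₀ (by positivity)]; linarith
    have hp2 : w (n + 2) ^ v ≤ w 0 ^ v := pow_le_pow_left₀ hwn2.le (hanti (Nat.zero_le _)) _
    have hpn : w n ^ v ≤ w 0 ^ v := pow_le_pow_left₀ hwn.le (hanti (Nat.zero_le _)) _
    have hn2 : w (n + 2) ≤ w n := hanti (by omega)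
    have hA : w n * w (n + 2) ^ v * (((n : ℝ) + 1) / ((n : ℝ) + 3)) ≤ w 0 ^ v * w n := by
      calc _ ≤ w n * w (n + 2) ^ v * 1 := mul_le_mul_of_nonneg_left h1 (by positivity)
        _ ≤ w n * w 0 ^ v * 1 := by
            refine mul_le_mul_of_nonneg_right (mul_le_mul_of_nonneg_left hp2 hwn.le) (by norm_num)
        _ = w 0 ^ v * w n := by ring
    have hB : (if n = 0 then (1 : ℝ) else 2) * w n ^ (v + 1) ≤ 2 * (w 0 ^ v * w n) := by
      have hle : (if n = 0 then (1 : ℝ) else 2) ≤ 2 := by split_ifs <;> norm_num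
      have h0 : 0 ≤ w n ^ (v + 1) := by positivity
      calc _ ≤ 2 * w n ^ (v + 1) := mul_le_mul_of_nonneg_right hle h0
        _ = 2 * (w n ^ v * w n) := by rw [pow_succ]
        _ ≤ 2 * (w 0 ^ v * w n) := by
            refine mul_le_mul_of_nonneg_left (mul_le_mul_of_nonneg_right hpn hwn.le) (by norm_num)
    have hC : w (n + 2) * w n ^ v * (((n : ℝ) + 3) / ((n : ℝ) + 1)) ≤ 3 * (w 0 ^ v * w n) := by
      calc _ ≤ w (n + 2) * w n ^ v * 3 := mul_le_mul_of_nonneg_left h2 (by positivity)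
        _ ≤ w n * w 0 ^ v * 3 :=
            mul_le_mul_of_nonneg_right (mul_le_mul hn2 hpn (by positivity) hwn.le) (by norm_num)
        _ = 3 * (w 0 ^ v * w n) := by ring
    linarith
  refine Summable.of_nonneg_of_le (fun n => ?_) hb ?_
  · have := (hpos n).le
    have := (hpos (n + 2)).le
    have : (0 : ℝ) ≤ (if n = 0 then (1 : ℝ) else 2) := by split_ifs <;> norm_num
    positivity
  · exact (((hsum.mul_left _).add ((hsum.mul_left _).mul_left 2)).add ((hsum.mul_left _).mul_left 3)).mul_left _

/-- **The abstract second-moment estimate.**  For an antitone, positive, summable `w : ℕ → ℝ` and `v : ℕ`: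
with `Z = Σ_n w_n^{v+1}`, `N = ¼ Σ_n [w_n w_{n+2}^v (n+1)/(n+3) + (1+[n≠0]) w_n^{v+1} + w_{n+2} w_n^v (n+3)/(n+1)]`,
`r = w_1/w_0`, `ρ = w_2/w_0`: `|N/Z − ¼(1 + 3ρ)| ≤ r^v · (1/12 + (9/4)(Σ_n w_{n+1})/w_0)`.
(The `n = 0` term of `N − ¼(1+3ρ)Z` is `(1/12) w_0 w_2^v ≤ (1/12) r^v w_0^{v+1}`; each further term has modulus
at most `(9/4) w_1^v w_n`.) -/
theorem abs_div_tsum_sq_sub_le (v : ℕ) :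
    |(∑' n : ℕ, (1 / 4 : ℝ) * (w n * w (n + 2) ^ v * (((n : ℝ) + 1) / ((n : ℝ) + 3)) +
        (if n = 0 then 1 else 2) * w n ^ (v + 1) + w (n + 2) * w n ^ v * (((n : ℝ) + 3) / ((n : ℝ) + 1)))) /
        (∑' n : ℕ, w n ^ (v + 1)) - 1 / 4 * (1 + 3 * (w 2 / w 0))| ≤
      (w 1 / w 0) ^ v * (1 / 12 + 9 / 4 * (∑' n : ℕ, w (n + 1)) / w 0) := by
  set N : ℝ := ∑' n : ℕ, (1 / 4 : ℝ) * (w n * w (n + 2) ^ v * (((n : ℝ) + 1) / ((n : ℝ) + 3)) +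
    (if n = 0 then 1 else 2) * w n ^ (v + 1) + w (n + 2) * w n ^ v * (((n : ℝ) + 3) / ((n : ℝ) + 1))) with hN
  set Z : ℝ := ∑' n : ℕ, w n ^ (v + 1) with hZ
  set S : ℝ := ∑' n : ℕ, w (n + 1) with hS
  set r : ℝ := w 1 / w 0 with hr
  set ρ : ℝ := w 2 / w 0 with hρ
  have hw0 := hpos 0
  have hw1 := hpos 1
  have hw2 := hpos 2
  have hS0 : 0 ≤ S := tsum_nonneg fun n => (hpos _).le
  have hr0 : 0 ≤ r := by positivity
  have hr1 : r ≤ 1 := (div_le_one hw0).mpr (hanti (by norm_num))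
  have hρ0 : 0 ≤ ρ := by positivity
  have hρ1 : ρ ≤ 1 := (div_le_one hw0).mpr (hanti (by norm_num))
  have hsumZ : Summable fun n => w n ^ (v + 1) := summable_pow_of_antitone hanti hpos hsum _ (by omega)
  have hsumN := summable_sqNumTerm hanti hpos hsum v
  have hsumS : Summable fun n => w (n + 1) := (summable_nat_add_iff 1).mpr hsum
  have hZge : w 0 ^ (v + 1) ≤ Z := hsumZ.le_tsum 0 (fun j _ => pow_nonneg (hpos j).le _)
  have hZpos : 0 < Z := lt_of_lt_of_le (pow_pos hw0 _) hZge
  set s : ℝ := 1 / 4 * (1 + 3 * ρ) with hs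
  have hs0 : 0 ≤ s := by positivity
  have hs1 : s ≤ 1 := by rw [hs]; linarith
  -- the difference as one series
  set D : ℕ → ℝ := fun n => (1 / 4 : ℝ) * (w n * w (n + 2) ^ v * (((n : ℝ) + 1) / ((n : ℝ) + 3)) +
    (if n = 0 then 1 else 2) * w n ^ (v + 1) + w (n + 2) * w n ^ v * (((n : ℝ) + 3) / ((n : ℝ) + 1))) -
    s * w n ^ (v + 1) with hD
  have hsumD : Summable D := hsumN.sub (hsumZ.mul_left _)
  have hdiff : N - s * Z = ∑' n, D n := by
    rw [hN, hZ, ← tsum_mul_left, ← hsumN.tsum_sub (hsumZ.mul_left _)]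
  have hD0 : D 0 = 1 / 12 * (w 0 * w 2 ^ v) := by
    rw [hD, hs, hρ]
    simp only [Nat.cast_zero, zero_add, if_true]
    have hw00 : w 0 ≠ 0 := hw0.ne'
    rw [pow_succ]
    field_simp
    ring
  have hD0le : |D 0| ≤ 1 / 12 * (w 1 ^ v * w 0) := by
    rw [hD0, abs_of_nonneg (by positivity)]
    have : w 2 ^ v ≤ w 1 ^ v := pow_le_pow_left₀ hw2.le (hanti (by norm_num)) _
    nlinarith [hw0]
  have hDtail : ∀ n, |D (n + 1)| ≤ 9 / 4 * (w 1 ^ v * w (n + 1)) := by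
    intro n
    have hwn1 := hpos (n + 1)
    have hwn3 := hpos (n + 1 + 2)
    have h1 : (((n + 1 : ℕ) : ℝ) + 1) / (((n + 1 : ℕ) : ℝ) + 3) ≤ 1 := by
      rw [div_le_one (by positivity)]; linarith
    have h2 : (((n + 1 : ℕ) : ℝ) + 3) / (((n + 1 : ℕ) : ℝ) + 1) ≤ 2 := by
      rw [div_le_iff₀ (by positivity)]; push_cast; linarith
    have hq1 : w (n + 1 + 2) ^ v ≤ w 1 ^ v := pow_le_pow_left₀ hwn3.le (hanti (by omega)) _
    have hq2 : w (n + 1) ^ v ≤ w 1 ^ v := pow_le_pow_left₀ hwn1.le (hanti (by omega)) _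
    have hq3 : w (n + 1 + 2) ≤ w (n + 1) := hanti (by omega)
    -- the three products and the subtracted term are each at most `c · w_1^v w_{n+1}`
    have hP1 : w (n + 1) * w (n + 1 + 2) ^ v * ((((n + 1 : ℕ) : ℝ) + 1) / (((n + 1 : ℕ) : ℝ) + 3)) ≤
        w 1 ^ v * w (n + 1) := by
      calc _ ≤ w (n + 1) * w (n + 1 + 2) ^ v * 1 := mul_le_mul_of_nonneg_left h1 (by positivity)
        _ ≤ w (n + 1) * w 1 ^ v * 1 :=
            mul_le_mul_of_nonneg_right (mul_le_mul_of_nonneg_left hq1 hwn1.le) (by norm_num)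
        _ = w 1 ^ v * w (n + 1) := by ring
    have hP2 : (if n + 1 = 0 then (1 : ℝ) else 2) * w (n + 1) ^ (v + 1) ≤ 2 * (w 1 ^ v * w (n + 1)) := by
      rw [if_neg (Nat.succ_ne_zero n), pow_succ]
      exact mul_le_mul_of_nonneg_left (mul_le_mul_of_nonneg_right hq2 hwn1.le) (by norm_num)
    have hP3 : w (n + 1 + 2) * w (n + 1) ^ v * ((((n + 1 : ℕ) : ℝ) + 3) / (((n + 1 : ℕ) : ℝ) + 1)) ≤
        2 * (w 1 ^ v * w (n + 1)) := by
      calc _ ≤ w (n + 1 + 2) * w (n + 1) ^ v * 2 := mul_le_mul_of_nonneg_left h2 (by positivity)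
        _ ≤ w (n + 1) * w 1 ^ v * 2 :=
            mul_le_mul_of_nonneg_right (mul_le_mul hq3 hq2 (by positivity) hwn1.le) (by norm_num)
        _ = 2 * (w 1 ^ v * w (n + 1)) := by ring
    have hP4 : s * w (n + 1) ^ (v + 1) ≤ w 1 ^ v * w (n + 1) := by
      rw [pow_succ]
      calc s * (w (n + 1) ^ v * w (n + 1)) ≤ 1 * (w (n + 1) ^ v * w (n + 1)) :=
            mul_le_mul_of_nonneg_right hs1 (by positivity)
        _ ≤ w 1 ^ v * w (n + 1) := by rw [one_mul]; exact mul_le_mul_of_nonneg_right hq2 hwn1.le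
    have hA : 0 ≤ w (n + 1) * w (n + 1 + 2) ^ v * ((((n + 1 : ℕ) : ℝ) + 1) / (((n + 1 : ℕ) : ℝ) + 3)) := by
      positivity
    have hB : 0 ≤ (if n + 1 = 0 then (1 : ℝ) else 2) * w (n + 1) ^ (v + 1) := by
      rw [if_neg (Nat.succ_ne_zero n)]; positivity
    have hC : 0 ≤ w (n + 1 + 2) * w (n + 1) ^ v * ((((n + 1 : ℕ) : ℝ) + 3) / (((n + 1 : ℕ) : ℝ) + 1)) := by
      positivity
    have hE : 0 ≤ s * w (n + 1) ^ (v + 1) := by positivity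
    rw [hD]
    simp only
    rw [abs_le]
    constructor <;> nlinarith
  -- `|N − sZ| ≤ (1/12) w_1^v w_0 + (9/4) w_1^v S`
  have hsumDtail : Summable fun n => D (n + 1) := (summable_nat_add_iff 1).mpr hsumD
  have habs : |N - s * Z| ≤ 1 / 12 * (w 1 ^ v * w 0) + 9 / 4 * (w 1 ^ v * S) := by
    rw [hdiff, hsumD.tsum_eq_zero_add]
    have htail : |∑' n, D (n + 1)| ≤ ∑' n, 9 / 4 * (w 1 ^ v * w (n + 1)) := by
      have h1 : ‖∑' n, D (n + 1)‖ ≤ ∑' n, ‖D (n + 1)‖ := norm_tsum_le_tsum_norm hsumDtail.norm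
      simp only [Real.norm_eq_abs] at h1
      exact h1.trans (hsumDtail.abs.tsum_le_tsum hDtail ((hsumS.mul_left _).mul_left _))
    rw [tsum_mul_left, tsum_mul_left, ← hS] at htail
    calc |D 0 + ∑' n, D (n + 1)| ≤ |D 0| + |∑' n, D (n + 1)| := abs_add_le _ _
      _ ≤ _ := add_le_add hD0le htail
  -- divide by `Z ≥ w_0^{v+1}`
  have hZ0 : Z ≠ 0 := hZpos.ne'
  have hw00 : w 0 ≠ 0 := hw0.ne'
  have hkey : N / Z - s = (N - s * Z) / Z := by field_simp
  rw [hkey, abs_div, abs_of_pos hZpos, div_le_iff₀ hZpos]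
  have hK : 0 ≤ r ^ v * (1 / 12 + 9 / 4 * S / w 0) := by
    have : 0 ≤ 9 / 4 * S / w 0 := by positivity
    positivity
  have hw1e : w 1 ^ v = r ^ v * w 0 ^ v := by
    rw [hr, div_pow, div_mul_cancel₀]
    positivity
  calc |N - s * Z| ≤ 1 / 12 * (w 1 ^ v * w 0) + 9 / 4 * (w 1 ^ v * S) := habs
    _ = r ^ v * (1 / 12 + 9 / 4 * S / w 0) * w 0 ^ (v + 1) := by
        rw [hw1e, pow_succ]
        field_simp
    _ ≤ r ^ v * (1 / 12 + 9 / 4 * S / w 0) * Z := mul_le_mul_of_nonneg_left hZge hK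

end Abstract

/-! ## §2. The SU(2) torus: the second moment of the plaquette up to an exponentially small remainder -/

/-- **`|⟨(½ tr U_{x₀})²⟩_{(ℤ/L)²,β} − ¼(1 + 3 I₃(2β)/I₁(2β))| ≤ (I₂(2β)/I₁(2β))^{L²−1}·(1/12 + (9/4) Σ_n I_{n+2}(2β)/I₁(2β))`**
for `β > 0`, every `L ≥ 1` and plaquette `x₀`: the second moment of the torus plaquette equals the
one-plaquette second moment `∫(½ tr U)² e^{β tr U}dU/∫e^{β tr U}dU = ¼(1 + 3 I₃(2β)/I₁(2β))` up to a
correction exponentially small in the volume. -/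
theorem abs_wilson_mean_su2a0_sq_plaquette_two_sub_le {L : ℕ} [NeZero L] {β : ℝ} (hβ : 0 < β)
    (x₀ : Site 2 L) :
    |∫ V, su2a0 (plaquetteHolonomy V x₀ 0 1) * su2a0 (plaquetteHolonomy V x₀ 0 1)
        ∂(wilsonMeasure (d := 2) (L := L) (fundamentalRep (Fin 2)) β) -
        1 / 4 * (1 + 3 * (besselI 3 (2 * β) / besselI 1 (2 * β)))| ≤
      (besselI 2 (2 * β) / besselI 1 (2 * β)) ^ (L ^ 2 - 1) *
        (1 / 12 + 9 / 4 * (∑' n : ℕ, besselI (n + 2) (2 * β)) / besselI 1 (2 * β)) := by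
  set w : ℕ → ℝ := fun n => Real.exp (-(2 * β)) * (besselI n (2 * β) - besselI (n + 2) (2 * β)) /
    ((n : ℝ) + 1) with hw
  have hanti : Antitone w := charCoeff_div_succ_antitone hβ
  have hpos : ∀ n, 0 < w n := charCoeff_div_succ_pos hβ
  have hsum : Summable w := summable_charCoeff_div_succ hβ.le
  have hV : 1 ≤ L ^ 2 := Nat.one_le_pow _ _ (Nat.pos_of_ne_zero (NeZero.ne L))
  obtain ⟨v, hv⟩ : ∃ v, L ^ 2 = v + 1 := ⟨L ^ 2 - 1, by omega⟩
  have hv1 : L ^ 2 - 1 = v := by omega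
  have habs := abs_div_tsum_sq_sub_le hanti hpos hsum v
  -- identify the series
  have hw' : ∀ n, w n = Real.exp (-(2 * β)) * besselI (n + 1) (2 * β) / β := fun n =>
    charCoeff_div_succ_eq_besselI n hβ.ne'
  have hI1 : 0 < besselI 1 (2 * β) := besselI_pos 1 (by linarith)
  have he : 0 < Real.exp (-(2 * β)) := Real.exp_pos _
  have hratio : w 1 / w 0 = besselI 2 (2 * β) / besselI 1 (2 * β) := by
    rw [hw' 1, hw' 0]
    field_simp
  have hratio2 : w 2 / w 0 = besselI 3 (2 * β) / besselI 1 (2 * β) := by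
    rw [hw' 2, hw' 0]
    field_simp
  have hS : 9 / 4 * (∑' n : ℕ, w (n + 1)) / w 0 =
      9 / 4 * (∑' n : ℕ, besselI (n + 2) (2 * β)) / besselI 1 (2 * β) := by
    have h1 : (fun n : ℕ => w (n + 1)) = fun n => (Real.exp (-(2 * β)) / β) * besselI (n + 2) (2 * β) := by
      funext n; rw [hw' (n + 1)]; ring
    rw [h1, tsum_mul_left, hw' 0]
    field_simp
  -- the character coefficients in terms of `w`: `c_n = (n+1) w_n`
  have hcw : ∀ n : ℕ, Real.exp (-(2 * β)) * (besselI n (2 * β) - besselI (n + 2) (2 * β)) =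
      ((n : ℝ) + 1) * w n := by
    intro n
    rw [hw]
    field_simp
  have hnum : ∀ n : ℕ, (1 / 4 : ℝ) *
      ((Real.exp (-(2 * β)) * (besselI n (2 * β) - besselI (n + 2) (2 * β))) *
          (Real.exp (-(2 * β)) * (besselI (n + 2) (2 * β) - besselI (n + 2 + 2) (2 * β))) ^ (L ^ 2 - 1) *
          ((((n : ℝ) + 2 + 1) ^ (L ^ 2)))⁻¹ +
        (if n = 0 then 1 else 2) *
          (Real.exp (-(2 * β)) * (besselI n (2 * β) - besselI (n + 2) (2 * β))) ^ (L ^ 2) *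
          ((((n : ℝ) + 1) ^ (L ^ 2)))⁻¹ +
        (Real.exp (-(2 * β)) * (besselI (n + 2) (2 * β) - besselI (n + 2 + 2) (2 * β))) *
          (Real.exp (-(2 * β)) * (besselI n (2 * β) - besselI (n + 2) (2 * β))) ^ (L ^ 2 - 1) *
          ((((n : ℝ) + 1) ^ (L ^ 2)))⁻¹) =
      (1 / 4 : ℝ) * (w n * w (n + 2) ^ v * (((n : ℝ) + 1) / ((n : ℝ) + 3)) +
        (if n = 0 then 1 else 2) * w n ^ (v + 1) + w (n + 2) * w n ^ v * (((n : ℝ) + 3) / ((n : ℝ) + 1))) := by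
    intro n
    rw [hcw n, hcw (n + 2), hv1, hv]
    have hn1 : ((n : ℝ) + 1) ≠ 0 := by positivity
    have hn3 : ((n : ℝ) + 3) ≠ 0 := by positivity
    have hc2 : (((n + 2 : ℕ) : ℝ) + 1) = (n : ℝ) + 3 := by push_cast; ring
    have hc3 : ((n : ℝ) + 2 + 1) = (n : ℝ) + 3 := by ring
    rw [hc2, hc3, mul_pow, mul_pow, mul_pow, pow_succ, pow_succ, pow_succ]
    field_simp
  have hden : ∀ n : ℕ, (Real.exp (-(2 * β)) * (besselI n (2 * β) - besselI (n + 2) (2 * β)) /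
      ((n : ℝ) + 1)) ^ (L ^ 2) = w n ^ (v + 1) := fun n => by rw [hv]
  rw [wilson_mean_su2a0_sq_plaquette_two hβ.le x₀, tsum_congr hnum, tsum_congr hden, ← hratio, ← hratio2,
    ← hS, hv1]
  exact habs

/-- **THE EXACT SINGLE-PLAQUETTE VARIANCE ON THE TORUS, UP TO AN EXPONENTIALLY SMALL REMAINDER.**  For
`β > 0`, every `L ≥ 1` and plaquette `x₀`, with `Var(½ tr U_{x₀}) = ⟨(½ tr U_{x₀})²⟩ − ⟨½ tr U_{x₀}⟩²` under
theory-2's Wilson measure on `(ℤ/L)²` and `v(β) = ¼(1 + 3 I₃(2β)/I₁(2β)) − (I₂(2β)/I₁(2β))²`: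
`|Var(½ tr U_{x₀}) − v(β)| ≤ (I₂(2β)/I₁(2β))^{L²−1}·(7/12 + (29/4) Σ_n I_{n+2}(2β)/I₁(2β))`. -/
theorem abs_variance_su2a0_plaquette_two_sub_le {L : ℕ} [NeZero L] {β : ℝ} (hβ : 0 < β)
    (x₀ : Site 2 L) :
    |(∫ V, su2a0 (plaquetteHolonomy V x₀ 0 1) * su2a0 (plaquetteHolonomy V x₀ 0 1)
          ∂(wilsonMeasure (d := 2) (L := L) (fundamentalRep (Fin 2)) β) -
        (∫ V, su2a0 (plaquetteHolonomy V x₀ 0 1)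
          ∂(wilsonMeasure (d := 2) (L := L) (fundamentalRep (Fin 2)) β)) ^ 2) -
        (1 / 4 * (1 + 3 * (besselI 3 (2 * β) / besselI 1 (2 * β))) -
          (besselI 2 (2 * β) / besselI 1 (2 * β)) ^ 2)| ≤
      (besselI 2 (2 * β) / besselI 1 (2 * β)) ^ (L ^ 2 - 1) *
        (7 / 12 + 29 / 4 * (∑' n : ℕ, besselI (n + 2) (2 * β)) / besselI 1 (2 * β)) := by
  haveI := secondCountableTopology_su2
  have h2 := abs_wilson_mean_su2a0_sq_plaquette_two_sub_le hβ x₀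
  have h1 := abs_wilson_mean_su2a0_plaquette_two_sub_le hβ x₀
  obtain ⟨hr0, hr1⟩ := besselI_two_div_one_lt_one hβ
  set r : ℝ := besselI 2 (2 * β) / besselI 1 (2 * β) with hr
  set S : ℝ := (∑' n : ℕ, besselI (n + 2) (2 * β)) / besselI 1 (2 * β) with hS
  set P : ℝ := ∫ V, su2a0 (plaquetteHolonomy V x₀ 0 1)
    ∂(wilsonMeasure (d := 2) (L := L) (fundamentalRep (Fin 2)) β) with hP
  set Q : ℝ := ∫ V, su2a0 (plaquetteHolonomy V x₀ 0 1) * su2a0 (plaquetteHolonomy V x₀ 0 1)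
    ∂(wilsonMeasure (d := 2) (L := L) (fundamentalRep (Fin 2)) β) with hQ
  have hS0 : 0 ≤ S := div_nonneg (tsum_nonneg fun n => besselI_nonneg _ (by linarith))
    (besselI_pos 1 (by linarith)).le
  -- `|P| ≤ 1`
  have hPle : |P| ≤ 1 := by
    rw [hP]
    haveI : IsProbabilityMeasure (wilsonMeasure (d := 2) (L := L) (fundamentalRep (Fin 2)) β) :=
      isProbabilityMeasure_wilsonMeasure (d := 2) (L := L) (fundamentalRep (Fin 2))
        (continuous_fundamentalRep _) β
    refine (abs_integral_le_integral_abs).trans ?_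
    have h : ∫ V, |su2a0 (plaquetteHolonomy V x₀ 0 1)|
        ∂(wilsonMeasure (d := 2) (L := L) (fundamentalRep (Fin 2)) β) ≤ ∫ V, (1 : ℝ)
        ∂(wilsonMeasure (d := 2) (L := L) (fundamentalRep (Fin 2)) β) := by
      refine integral_mono_of_nonneg (ae_of_all _ fun V => abs_nonneg _) (integrable_const _)
        (ae_of_all _ fun V => abs_su2a0_le_one _)
    simpa using h
  have h1' : 9 / 4 * (∑' n : ℕ, besselI (n + 2) (2 * β)) / besselI 1 (2 * β) = 9 / 4 * S := by
    rw [hS, mul_div_assoc]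
  have h2' : 5 / 2 * (∑' n : ℕ, besselI (n + 2) (2 * β)) / besselI 1 (2 * β) = 5 / 2 * S := by
    rw [hS, mul_div_assoc]
  have h3' : 29 / 4 * (∑' n : ℕ, besselI (n + 2) (2 * β)) / besselI 1 (2 * β) = 29 / 4 * S := by
    rw [hS, mul_div_assoc]
  rw [h1'] at h2
  rw [h2'] at h1
  rw [h3']
  -- `|P² − r²| ≤ 2 |P − r|`
  have hsq : |P ^ 2 - r ^ 2| ≤ 2 * |P - r| := by
    have : P ^ 2 - r ^ 2 = (P - r) * (P + r) := by ring
    rw [this, abs_mul, mul_comm]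
    refine mul_le_mul_of_nonneg_right ?_ (abs_nonneg _)
    calc |P + r| ≤ |P| + |r| := abs_add_le _ _
      _ ≤ 1 + 1 := add_le_add hPle (by rw [abs_of_nonneg hr0]; exact hr1.le)
      _ = 2 := by norm_num
  have hm : 0 ≤ r ^ (L ^ 2 - 1) := pow_nonneg hr0 _
  calc |Q - P ^ 2 - (1 / 4 * (1 + 3 * (besselI 3 (2 * β) / besselI 1 (2 * β))) - r ^ 2)|
      = |(Q - 1 / 4 * (1 + 3 * (besselI 3 (2 * β) / besselI 1 (2 * β)))) - (P ^ 2 - r ^ 2)| := by ring_nf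
    _ ≤ |Q - 1 / 4 * (1 + 3 * (besselI 3 (2 * β) / besselI 1 (2 * β)))| + |P ^ 2 - r ^ 2| := abs_sub _ _
    _ ≤ r ^ (L ^ 2 - 1) * (1 / 12 + 9 / 4 * S) + 2 * (r ^ (L ^ 2 - 1) * (1 / 4 + 5 / 2 * S)) :=
        add_le_add h2 (hsq.trans (mul_le_mul_of_nonneg_left h1 (by norm_num)))
    _ = r ^ (L ^ 2 - 1) * (7 / 12 + 29 / 4 * S) := by ring

/-! ## §3. The thermodynamic limit of the second moment -/

/-- **`⟨(½ tr U_0)²⟩_{(ℤ/(L+1))²,β} → ¼(1 + 3 I₃(2β)/I₁(2β))`** as `L → ∞` (`β > 0`). -/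
theorem tendsto_wilson_mean_su2a0_sq_plaquette_two {β : ℝ} (hβ : 0 < β) :
    Tendsto (fun L : ℕ => ∫ V, su2a0 (plaquetteHolonomy V (0 : Site 2 (L + 1)) 0 1) *
          su2a0 (plaquetteHolonomy V (0 : Site 2 (L + 1)) 0 1)
        ∂(wilsonMeasure (d := 2) (L := L + 1) (fundamentalRep (Fin 2)) β))
      atTop (𝓝 (1 / 4 * (1 + 3 * (besselI 3 (2 * β) / besselI 1 (2 * β))))) := by
  obtain ⟨hr0, hr1⟩ := besselI_two_div_one_lt_one hβ
  set r : ℝ := besselI 2 (2 * β) / besselI 1 (2 * β) with hr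
  set K : ℝ := 1 / 12 + 9 / 4 * (∑' n : ℕ, besselI (n + 2) (2 * β)) / besselI 1 (2 * β) with hK
  have hexp : Tendsto (fun L : ℕ => (L + 1) ^ 2 - 1) atTop atTop := by
    refine tendsto_atTop_mono (fun L => ?_) tendsto_id
    have : (L + 1) ^ 2 = L * L + 2 * L + 1 := by ring
    simp only [id_eq]
    omega
  have hpow : Tendsto (fun L : ℕ => r ^ ((L + 1) ^ 2 - 1)) atTop (𝓝 0) :=
    (tendsto_pow_atTop_nhds_zero_of_lt_one hr0 hr1).comp hexp
  have hbound : Tendsto (fun L : ℕ => r ^ ((L + 1) ^ 2 - 1) * K) atTop (𝓝 0) := by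
    simpa using hpow.mul_const K
  rw [tendsto_iff_norm_sub_tendsto_zero]
  refine squeeze_zero (fun L => norm_nonneg _) (fun L => ?_) hbound
  rw [Real.norm_eq_abs]
  exact abs_wilson_mean_su2a0_sq_plaquette_two_sub_le (L := L + 1) hβ 0

end Summit.Ventures.LatticeQCDFlow.Scoring
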